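import Summits.BirchSwinnertonDyer.BirchSwinnertonDyer.Theses.UniversalToricDescent

/-!
# RK-6 v2 — POST-APPLY certificates (pen bsd-wall-pss3x g8; route UniversalToricDescent rev 80 5673f3168913 / rev 81 92328690b280)

The re-key is live: closes binds hP : `ToricDefectEitherRoadAtThree` (stmt-24209) and hKr : `ToricKernelAtThreeApZeroOddRationalOfPrint`
(stmt-24208); `RationalSplitIMCInclusionAtThree` is stmt-24207; 26976 `ToricDefectWallMuAtThree` is aside (= 24209's left disjunct).
This file proves, against the LIVE route file, that nothing was lost:
* the integral wall 20395 implies the rational wall 24207 (k = 0);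
* the old package 26976 implies the new package 24209 (`Or.inl`), and (A, wall, μ_twin) feed it too (`Or.inr`);
so every road that closed the route at rev 79 still closes it at rev ≥ 80 (kernel⁵ 22543 ✓ is still the integral road's binder).
-/

namespace Summit.BirchSwinnertonDyer.BirchSwinnertonDyer.Theses.UniversalToricDescent.RK6v2Certs

set_option linter.dupNamespace false

/-- the integral wall is the k = 0 case of the rational wall (cert that 20395 stays a sufficient road). -/
theorem rationalSplitIMCInclusionAtThree_of_wall :
    AdditiveSplitIMCInclusionAtThree → RationalSplitIMCInclusionAtThree := by
  intro hw W _ _ N _ K _ _ Dt hO6 hsurj hrk hN hK hH κ hκ γ _ 𝔭 h3 hram hdeg 𝔭' h3' hne ι' hι ΩK Ωp L hΩK hΩp hL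
  have h := hw W N K Dt hO6 hsurj hrk hN hK hH κ hκ γ 𝔭 h3 hram hdeg 𝔭' h3' hne ι' hι ΩK Ωp L hΩK hΩp hL
  rw [Ideal.span_singleton_le_iff_mem] at h
  exact ⟨0, by simpa using h⟩

/-- the OLD package (integral road, 26976) is the left disjunct of the new closes binder 24209. -/
theorem toricDefectEitherRoadAtThree_of_old (h : ToricDefectWallMuAtThree) : ToricDefectEitherRoadAtThree := Or.inl h

/-- the integral pieces also feed the rational disjunct componentwise (k = 0), given A. -/
theorem toricDefectEitherRoadAtThree_of_sigma_wall (hA : SigmaCongruenceAtThree) (hw : AdditiveSplitIMCInclusionAtThree)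
    (hμ : TwinMuZeroAtThree) : ToricDefectEitherRoadAtThree :=
  Or.inr ⟨hA, rationalSplitIMCInclusionAtThree_of_wall hw, hμ⟩

/-- the rational pieces feed the new binder directly. -/
theorem toricDefectEitherRoadAtThree_of_rational (hA : SigmaCongruenceAtThree) (hr : RationalSplitIMCInclusionAtThree)
    (hμ : TwinMuZeroAtThree) : ToricDefectEitherRoadAtThree :=
  Or.inr ⟨hA, hr, hμ⟩

end Summit.BirchSwinnertonDyer.BirchSwinnertonDyer.Theses.UniversalToricDescent.RK6v2Certs
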